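import Mathlib
import HarnessLib
import Summits.HubbardSuperconductivity.HubbardSuperconductivity.Theorems.FunctionFieldCertificateWindowInfraredBoundStubShellCover

/-!
# Crux `WindowInfraredBound` (stmt-HubbardSuperconductivity-1089) — line `dyadic-halving-cascade`
# (lead skeleton; lead c3 2026-08-16, integrated by lead c4: `stub_shellCover` LANDED p107924 — ONE sorry left)

Line idea (card `Cruxes/WindowInfraredBound/Ideas/dyadic-halving-cascade.md`, ideator sketch
`Cruxes/WindowInfraredBound/SketchIdeator2.lean`, triage r1-1 / r1-2 pass): the window infrared bound
is the UV Parseval ceiling `Σ_m S_ψ(m) ≤ 32 L²` (landed, `wib_sum_pairStructureFactor_le`) transported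
down the dyadic scales `ρ_k = ε₀ 2^{-k}` by ONE halving inequality on smooth Littlewood–Paley shells of
the SAME ground state's `d`-wave pair structure factor,

  (Dbl)  `T^φ_ψ(ρ) ≤ ½ · T^φ_ψ(2ρ) + B₁ ρ² L² + B₂ L`   for `0 < ρ ≤ ε₀/2`,
  `T^φ_ψ(ρ) := Σ_{m ≠ 0} φ(|q_m|/ρ) S_ψ(m)`, `φ(u) = max 0 (1 − |log₂ u|)` (log-tent, support `[1/2, 2]`).

Composition (this file; sorry-free outside `stub_dyadicHalving`):
* `stub_dyadicHalving` — (Dbl) for every normalised `(N_L, 0)`-sector ground state (the line's single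
  physics input; HARDEST; open, no supplier in print);
* `stub_shellCover` — LANDED (p107924): single-state harmonic analysis on `(ℤ/Lℤ)²`: for ONE normalised Fock
  vector obeying the halving inequality at all scales `ρ ≤ ε₀/2`, the crux's sharp window sum is
  `≤ (8(32 + B₁ε₀²)/ε₀ + 4B₂) · ε · L²` for `0 < ε ≤ ε₀/2` (geometric cascade `f(k) ≤ (32L² + B₁ε₀²L²)/2^k + 2B₂L`
  from the free anchor `f(0) ≤ 32L²`; shell cover `1_{0<|q|≤ε} ≤ φ(|q|/ρ_{k*}) + φ(|q|/ρ_{k*+1})` with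
  `ρ_{k*} ≤ 2ε`; at most `2εL/π` scales with `ρ_k ≥ π/L` carry a nonzero shell);
* `WindowInfraredBound_of` — threads the quantifiers (`ε₀ ↦ ε₀/2`), one line over the two stubs.

No definition (the log-tent and the shell sums are written inline), no named fact.
Sources: Kennedy–Lieb–Shastry, PRL 61 (1988) 2582 (Parseval sum rule / infrared-bound shape);
T. Balaban, CMP 167 (1995) 103 and CMP 182 (1996) 675 (scale-recursive fluctuation bounds — the supplier
CLASS the card names for (Dbl); nothing there proves (Dbl) for the Hubbard model).
-/

namespace Summit.HubbardSuperconductivity.HubbardSuperconductivity.Theorems.WindowInfraredBound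

-- summit = problem name (single-conjunct summit, D-0017): `HubbardSuperconductivity` occurs twice in the path
set_option linter.dupNamespace false

open Literature.MathematicalPhysics.QuantumLattice Literature.Probability.LatticeModels Matrix Finset
open scoped ComplexOrder ComplexConjugate
open Summit.HubbardSuperconductivity.HubbardSuperconductivity.Theses

/-! ## The stubs -/

/-- **Stub (Dbl) — `stub_dyadicHalving` (HARDEST; the line's single physics input).** For all `U > 0`,
`δ ∈ (0, 1/2)` there are `B₁, B₂ ≥ 0`, `ε₀ > 0`, `L₀` such that for every even `L ≥ L₀`, every normalised
`(N_L, S^z = 0)`-sector ground state `ψ` of `hubbardTorus 2 L 1 U` (`N_L = 2⌊(1-δ)L²/2⌋`) and every scale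
`0 < ρ ≤ ε₀/2`, halving the scale at most halves the smooth shell pair weight up to a flat defect and a
bottom-of-spectrum defect:
`Σ_{m≠0} φ(|q_m|/ρ) S_ψ(m) ≤ ½ Σ_{m≠0} φ(|q_m|/(2ρ)) S_ψ(m) + B₁ ρ² L² + B₂ L`,
`φ(u) = max 0 (1 − |log₂ u|)`, `S_ψ = pairStructureFactor dWaveFormFactor L ψ`, `|q_m|² = momentumNormSq L m`.
Shell-averaged form of "infrared exponent ≤ 1" (a linear Goldstone mode saturates it with ratio ½; a flat
structure factor gives ratio ¼); OPEN physics input, proved nowhere (no reflection positivity off half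
filling; no block-RG control of doped-Hubbard ground states). [folklore] -/
theorem stub_dyadicHalving :
    ∀ U : ℝ, 0 < U → ∀ δ ∈ Set.Ioo (0:ℝ) (1 / 2), ∃ B₁ B₂ ε₀ : ℝ, 0 ≤ B₁ ∧ 0 ≤ B₂ ∧ 0 < ε₀ ∧ ∃ L₀ : ℕ,
      ∀ (L : ℕ) [NeZero L], L₀ ≤ L → Even L → ∀ ψ : Fock (Orb (FermionTorus 2 L)), star ψ ⬝ᵥ ψ = 1 →
        IsGroundStateInSector (hubbardTorus 2 L 1 U) (2 * ⌊(1 - δ) * (L : ℝ) ^ 2 / 2⌋₊) 0 ψ →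
          ∀ ρ ∈ Set.Ioc (0:ℝ) (ε₀ / 2),
            (∑ m : TorusSite 2 L, if m ≠ 0 then
                max 0 (1 - |Real.logb 2 (Real.sqrt (momentumNormSq L m) / ρ)|) *
                  pairStructureFactor dWaveFormFactor L ψ m else 0) ≤
              (∑ m : TorusSite 2 L, if m ≠ 0 then
                  max 0 (1 - |Real.logb 2 (Real.sqrt (momentumNormSq L m) / (2 * ρ))|) *
                    pairStructureFactor dWaveFormFactor L ψ m else 0) / 2 +
                B₁ * ρ ^ 2 * (L : ℝ) ^ 2 + B₂ * (L : ℝ) := by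
  sorry

-- `stub_shellCover` is LANDED (p107924, `Theorems/FunctionFieldCertificateWindowInfraredBoundStubShellCover.lean`,
-- same namespace) and is used below by name.

/-! ## The composition (sorry-free below this line) -/

/-- **The line closes the crux (modulo its stubs): `WindowInfraredBound_of`.** (Dbl) in every sector
ground state (`stub_dyadicHalving`) ⇒ [single-state cover + cascade, `stub_shellCover`, with `ε₀ ↦ ε₀/2`
and `C = 8(32 + B₁ε₀²)/ε₀ + 4B₂`] `FunctionFieldCertificate.WindowInfraredBound` (read in tree vocabulary
through `wib_iff_pairStructureFactor`, `Iff.rfl`). [folklore] -/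
theorem WindowInfraredBound_of : FunctionFieldCertificate.WindowInfraredBound := by
  refine wib_iff_pairStructureFactor.2 fun U hU δ hδ => ?_
  obtain ⟨B₁, B₂, ε₀, hB₁, hB₂, hε₀, L₀, h⟩ := stub_dyadicHalving U hU δ hδ
  refine ⟨8 * (32 + B₁ * ε₀ ^ 2) / ε₀ + 4 * B₂, ε₀ / 2, by positivity, by positivity, L₀, ?_⟩
  intro ε hε L _ hL hev ψ hψ hgs
  exact stub_shellCover L ψ hψ hB₁ hB₂ hε.1 hε.2 (h L hL hev ψ hψ hgs)

/-- The `KacWindowPenalty` copy of the crux (verbatim the same proposition, `wib_functionField_iff_kac`).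
[folklore] -/
theorem WindowInfraredBound_of_kac : KacWindowPenalty.WindowInfraredBound :=
  wib_functionField_iff_kac.1 WindowInfraredBound_of

end Summit.HubbardSuperconductivity.HubbardSuperconductivity.Theorems.WindowInfraredBound
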